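import Mathlib.AlgebraicGeometry.Morphisms.Immersion
import Mathlib.Algebra.MonoidAlgebra.Basic
import Literature.AlgebraicGeometry.Motives.Varieties
import HarnessLib

/-!
# Schemes partitioned into split tori (`HasSplitTorusPartition`)

Topic `AlgebraicGeometry/Motives`; namespace `Literature.AlgebraicGeometry.Motives`. A DEFINITION
file (item `defn-HasSplitTorusPartition`, for route `HodgeConjecture/TateCuspKLift`, where the
predicate is inlined verbatim in the items `CuspAccessibleHodge` / `ArithmeticTateRestriction`, and
route `MilnorFluxCusps`).

## The notion

A `k`-scheme `X` **has a split torus partition** if it is, set-theoretically, a finite disjoint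
union of locally closed subschemes each of which is `k`-isomorphic to a split torus
`𝔾ₘᵇ = Spec k[ℤᵇ] = Spec k[t₁^{±1}, …, t_b^{±1}]` (`b` depending on the piece): there are finitely
many immersions of `k`-schemes `eᵢ : Spec k[ℤ^{bᵢ}] ⟶ X` (Mathlib `AlgebraicGeometry.IsImmersion`:
an open immersion followed by a closed immersion, i.e. an isomorphism onto a locally closed
subscheme) whose images are pairwise disjoint and cover `X`. This is the torus analogue of a
*cellular* variety (Fulton, *Intersection Theory*, Ex. 1.9.1: "`X` has a filtration by closed
subschemes with `Xᵢ - Xᵢ₋₁` a disjoint union of affine spaces `𝔸^{nᵢⱼ}`") and a special case of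
Totaro's *linear schemes* (Totaro, *Chow groups, Chow cohomology, and linear varieties*, Forum
Math. Sigma 2 (2014), §1 and §3: "the class of schemes obtained by an inductive procedure starting
with affine space of any dimension over `k`, in such a way that the complement of a linear scheme
imbedded in affine space is a linear scheme, and a scheme stratified into a finite disjoint union
of linear schemes is a linear scheme"; "each orbit [of a split solvable group] is isomorphic to
`(𝔾ₘ)ᵃ × 𝔸ᵇ`", §1): the split tori `𝔾ₘᵇ ⊂ 𝔸ᵇ` are linear, hence so is every scheme with a split
torus partition, and over a number field its motive is mixed Tate (the route's informal
dictionary; Deligne–Goncharov 2005, §1). Examples: `𝔾ₘᵇ` itself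
(`hasSplitTorusPartition_splitTorusOver`), `𝔸ⁿ = ⊔_{S ⊆ {1..n}} 𝔾ₘ^{|S|}`,
`ℙⁿ = ⊔ᵢ 𝔸ⁱ`, smooth projective toric varieties (orbit stratification), and snc unions of toric
varieties glued along torus-invariant strata (the toroidal cusp fibres of the route).

## What is here

* `splitTorusOver k b = Spec k[ℤᵇ]` as a `k`-scheme (`specOver k (AddMonoidAlgebra k (Fin b →₀ ℤ))`,
  literally the term inlined in the route);
* `HasSplitTorusPartition X` — the predicate, VERBATIM the clause inlined in route `TateCuspKLift`
  (index type `ι : Type` with `Finite ι`, exponents `b : ι → ℕ`, immersions `e i`, pairwise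
  disjoint ranges of the underlying continuous maps, union `= Set.univ`), so that the route's items
  are literally `HasSplitTorusPartition X₁` (`hasSplitTorusPartition_iff`);
* proved API: `hasSplitTorusPartition_iff`; a split torus is torus-partitioned (one piece, the
  identity: `hasSplitTorusPartition_splitTorusOver`); the empty scheme is (no pieces:
  `hasSplitTorusPartition_of_isEmpty`); invariance under `k`-isomorphism
  (`HasSplitTorusPartition.of_iso`).

Not here (theorems about the notion, i.e. the "API facts" of the request, each a genuine piece of
scheme theory over Mathlib's `Scheme`): `𝔸ⁿ` and `ℙⁿ` are torus-partitioned, stability under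
products and disjoint unions, "affinely paved ⟹ torus-partitioned", snc unions of toric
varieties, and the motivic dictionary "torus-partitioned over a number field ⟹ mixed Tate". No
named fact is introduced.

## References

* B. Totaro, *Chow groups, Chow cohomology, and linear varieties*, Forum Math. Sigma 2 (2014), e17,
  §1 and §3 (linear schemes). [Totaro2014ChowLinear]
* W. Fulton, *Intersection Theory*, 2nd ed. (1998), Example 1.9.1 (cellular decompositions).
  [Fulton1998]
* P. Deligne, A. B. Goncharov, *Groupes fondamentaux motiviques de Tate mixte*, Ann. Sci. ÉNS 38
  (2005), §1 (mixed Tate motives over a number field). [DeligneGoncharov2005]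
-/

universe u

open CategoryTheory AlgebraicGeometry

namespace Literature.AlgebraicGeometry.Motives

section Def

variable (k : Type u) [CommRing k]

/-- **The split torus `𝔾ₘᵇ = Spec k[ℤᵇ]` over `k`** (`k[ℤᵇ] = k[t₁^{±1}, …, t_b^{±1}]` as the
group algebra `AddMonoidAlgebra k (Fin b →₀ ℤ)`), as a `k`-scheme; literally the term
`specOver k (AddMonoidAlgebra k (Fin b →₀ ℤ))` inlined in route `TateCuspKLift`.
[cite: Totaro2014ChowLinear, §3 (linear schemes; 𝔸¹ = 𝔾ₘ ⊔ pt)] -/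
noncomputable abbrev splitTorusOver (b : ℕ) : SchemeOver k :=
  specOver k (AddMonoidAlgebra k (Fin b →₀ ℤ))

variable {k}

/-- **`X` has a split torus partition**: finitely many immersions of `k`-schemes
`eᵢ : 𝔾ₘ^{bᵢ} = Spec k[ℤ^{bᵢ}] ⟶ X` (isomorphisms onto locally closed subschemes) with pairwise
disjoint images covering `X` — `X` is set-theoretically the disjoint union of finitely many locally
closed split tori. The torus analogue of a cellular scheme (Fulton, Ex. 1.9.1) and a special case
of Totaro's linear schemes (2014, §3); verbatim the clause inlined in the items of route
`HodgeConjecture/TateCuspKLift`. [cite: Totaro2014ChowLinear, §1 and §3 (linear schemes)]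
[cite: Fulton1998, Example 1.9.1 (cellular decomposition)] -/
def HasSplitTorusPartition (X : SchemeOver k) : Prop :=
  ∃ (ι : Type) (_ : Finite ι) (b : ι → ℕ)
    (e : ∀ i : ι, specOver k (AddMonoidAlgebra k (Fin (b i) →₀ ℤ)) ⟶ X),
    (∀ i, AlgebraicGeometry.IsImmersion (e i).left) ∧
    (Pairwise fun i j => Disjoint (Set.range fun x => (e i).left.base x)
      (Set.range fun x => (e j).left.base x)) ∧
    (⋃ i, Set.range fun x => (e i).left.base x) = Set.univ

/-- Unfolding: `HasSplitTorusPartition X` is literally the clause inlined in route `TateCuspKLift`.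
[cite: Totaro2014ChowLinear, §3] -/
theorem hasSplitTorusPartition_iff (X : SchemeOver k) :
    HasSplitTorusPartition X ↔
      ∃ (ι : Type) (_ : Finite ι) (b : ι → ℕ)
        (e : ∀ i : ι, specOver k (AddMonoidAlgebra k (Fin (b i) →₀ ℤ)) ⟶ X),
        (∀ i, AlgebraicGeometry.IsImmersion (e i).left) ∧
        (Pairwise fun i j => Disjoint (Set.range fun x => (e i).left.base x)
          (Set.range fun x => (e j).left.base x)) ∧
        (⋃ i, Set.range fun x => (e i).left.base x) = Set.univ :=
  Iff.rfl

end Def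

/-! ### API -/

section API

variable {k : Type u} [CommRing k]

/-- **A split torus is torus-partitioned** (one piece: the identity immersion). [folklore] -/
theorem hasSplitTorusPartition_splitTorusOver (b : ℕ) :
    HasSplitTorusPartition (splitTorusOver k b) := by
  refine ⟨Unit, inferInstance, fun _ ↦ b, fun _ ↦ 𝟙 _, fun _ ↦ ?_, ?_, ?_⟩
  · rw [Over.id_left]
    infer_instance
  · exact Subsingleton.pairwise
  · apply Set.eq_univ_of_forall
    intro x
    exact Set.mem_iUnion.2 ⟨(), x, rfl⟩

/-- **The empty `k`-scheme is torus-partitioned** (no pieces). [folklore] -/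
theorem hasSplitTorusPartition_of_isEmpty (X : SchemeOver k) [IsEmpty X.left] :
    HasSplitTorusPartition X := by
  refine ⟨PEmpty, inferInstance, fun i ↦ i.elim, fun i ↦ i.elim, fun i ↦ i.elim,
    fun i ↦ i.elim, ?_⟩
  rw [Set.iUnion_of_empty]
  exact (Set.eq_empty_of_isEmpty Set.univ).symm

/-- **Invariance under `k`-isomorphism**: a `k`-scheme isomorphic over `k` to a torus-partitioned
one is torus-partitioned (compose the immersions with the isomorphism; its underlying map is a
homeomorphism, so disjointness and the covering property are transported). [folklore] -/
theorem HasSplitTorusPartition.of_iso {X Y : SchemeOver k} (f : X ≅ Y)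
    (h : HasSplitTorusPartition X) : HasSplitTorusPartition Y := by
  obtain ⟨ι, hι, b, e, himm, hdisj, hcov⟩ := h
  -- the underlying isomorphism of schemes and its homeomorphism
  let F : X.left ≅ Y.left := (Over.forget _).mapIso f
  have hinj : Function.Injective fun x ↦ f.hom.left.base x := (Scheme.homeoOfIso F).injective
  have hsurj : Function.Surjective fun x ↦ f.hom.left.base x := (Scheme.homeoOfIso F).surjective
  have hrange : ∀ i, (Set.range fun x ↦ (e i ≫ f.hom).left.base x) =
      (fun x ↦ f.hom.left.base x) '' Set.range fun x ↦ (e i).left.base x := fun i ↦ by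
    rw [← Set.range_comp]
    rfl
  refine ⟨ι, hι, b, fun i ↦ e i ≫ f.hom, fun i ↦ ?_, ?_, ?_⟩
  · rw [Over.comp_left]
    haveI := himm i
    haveI : IsIso f.hom.left := (inferInstance : IsIso F.hom)
    infer_instance
  · intro i j hij
    rw [hrange, hrange]
    exact (Set.disjoint_image_iff hinj).2 (hdisj hij)
  · apply Set.eq_univ_of_forall
    intro y
    obtain ⟨x, rfl⟩ := hsurj y
    have hx : x ∈ ⋃ i, Set.range fun x ↦ (e i).left.base x := hcov ▸ Set.mem_univ x
    obtain ⟨i, hi⟩ := Set.mem_iUnion.1 hx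
    exact Set.mem_iUnion.2 ⟨i, by rw [hrange]; exact Set.mem_image_of_mem _ hi⟩

end API

end Literature.AlgebraicGeometry.Motives
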